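import Literature.AnabelianGeometry.AbsoluteAnabelian.AbsTopIII.Thm19CuspidalDegreeProofs
import Literature.AnabelianGeometry.AbsoluteAnabelian.AbsTopIII.CuspidalSynchronizationHolds
import HarnessLib

/-!
# [AbsTopIII] Thm. 1.9 (b) for several rational cusps, modulo cusp-synchronization presentations only

Mochizuki, *Topics in Absolute Anabelian Geometry III*, §1, Thm. 1.9 (b) p. 37 (lit key
`paper:url-5493eb38cbb7`): "One constructs the natural isomorphisms `I_z ⥲ μ_Ẑ(Π_U) := M_Z` … via the
technique of Proposition 1.4, (ii)."

Proof-only companion (abc-iut cell, DAG node `AbsTopIII:Thm1.9`, FACT-LIST row F-0346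
`CurveModel.Thm_1_9_b`).  abc-iut-w5-d213's `CurveModel.thm_1_9_b_of_presentations`
(`Thm19CuspidalDegreeProofs.lean`, p416008) reduces the several-cusps named fact `CurveModel.Thm_1_9_b`
to (h9) the natural single-cusp form `CurveModel.Thm_1_9_b_natural` and (hP) the existence, for every
cofinite open `U ⊆ Z` as in (b), of a system of cusp-synchronization presentations
`U ⊆ Z ∖ {z} ⊆ Z` (`CurveModel.CuspSyncPresentation`).  The hypothesis (h9) is a THEOREM for every
model: `CurveModel.thm_1_9_b_natural_holds` (`CuspidalSynchronizationHolds.lean`, abc-iut-L4-t1 /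
abc-iut-L4-t6, from the structure theorem for free procyclic groups).  Composing the two leaves
`Thm_1_9_b` conditional on (hP) alone.  No new definition, no named fact.
HONEST FRAMING: nothing here bears on [IUTchIII] Cor. 3.12; typed ≠ proved for the node as a whole
(the presentations (hP) carry the Prop. 1.4 (i)/(ii) inputs as data).
-/

namespace Literature.AnabelianGeometry.AbsoluteAnabelian.AbsTopIII

universe u

/-- **[AbsTopIII] Thm. 1.9 (b) (several rational cusps), modulo presentations only**: if every
cofinite open `U ⊆ Z` with `U`, `Z` scheme-like, `Z` proper of genus `≥ 2` and all cusps of `U`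
rational admits a system of cusp-synchronization presentations (`CuspSyncPresentation`: the third
curves `U ⊆ Z ∖ {z} ⊆ Z` with their Prop. 1.4 (i)/(ii) data), then the named fact
`CurveModel.Thm_1_9_b M` holds — the `D_z`-equivariant isomorphism `I_z ≃ M_Z` being THE natural
synchronization, bijective by `CurveModel.thm_1_9_b_natural_holds`.
[cite: MochizukiAbsTopIII2015, Thm 1.9 (b) p.37] -/
theorem CurveModel.thm_1_9_b_of_cuspSyncPresentations (M : CurveModel.{u})
    (hP : ∀ (U Z : M.Curve) (h : M.IsCofiniteOpen U Z), M.IsScheme U → M.IsScheme Z → M.IsProper Z →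
      2 ≤ M.genus Z → (∀ c : (M.cusps U).Cusp, (M.cusps U).IsRational c) →
        Nonempty (M.CuspSyncPresentation h)) :
    M.Thm_1_9_b :=
  M.thm_1_9_b_of_presentations M.thm_1_9_b_natural_holds hP

end Literature.AnabelianGeometry.AbsoluteAnabelian.AbsTopIII
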